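import Summits.AnomalousDissipation.AnomalousDissipation.Theorems.SymmetricOrLoudPlanarStatesEject.Negative.SlicePosPinned
import Literature.Analysis.FluidPDE.TurbWave0
import HarnessLib

/-!
# The ejection predicate at a positive time is pinned

Negative-lane record (decomp-ad crit-1 g23), closing the loop of `SliceZeroEject.lean` (the time-zero slice of
`Torus.IsGlobalLerayHopf` is free: `sliceZero_eject`) and `SlicePosPinned.lean` (slices at positive times are
pinned a.e.: `sliceGlobal_ae_eq_of_eq_off`).  The two quantities entering the «ejection» conclusions of the lens-4
items 30314 · 30320 · 31392 · 31393 · 31394 · 32462 — the energy `∫‖v‖²` and the planar-symmetry defect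
`⨅_{q ≠ 0} ½ ∫₀¹ ∫ ‖v (x + s q̃) − v x‖² dx ds` — are invariant under a.e.-modification of the field
(`integral_norm_sq_shift_sub_congr_ae`, `defect_congr_ae`; translation preserves Haar measure on the torus).
Hence for two global Leray–Hopf solutions that agree off a single time `t₀ > 0` the ejection predicate
`0 < defect (u t₀) ∧ c₀ ∫‖u t₀‖² ≤ defect (u t₀)` has the same truth value (`sliceGlobal_eject_iff_of_eq_off`):
the repaired conclusions `∃ t : ℝ, 0 < t ∧ …` cannot be decided by editing a slice.  References no `Theses`
declaration.
-/

noncomputable section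

set_option linter.dupNamespace false

namespace Summit.AnomalousDissipation.AnomalousDissipation.Theorems.SymmetricOrLoudPlanarStatesEject.Negative

open MeasureTheory Filter Set Topology
open Literature.Analysis.FluidPDE Literature.Analysis.FluidPDE.Torus

variable {d : Type*} [Fintype d]

/-- `∫ ‖v (x + a) − v x‖²` is invariant under a.e.-modification of `v` (right translation by `a` preserves the
Haar measure of the torus). [folklore] -/
theorem integral_norm_sq_shift_sub_congr_ae {v v' : UnitAddTorus d → EuclideanSpace ℝ d} (h : v =ᵐ[volume] v')
    (a : UnitAddTorus d) :
    ∫ x, ‖v (x + a) - v x‖ ^ 2 = ∫ x, ‖v' (x + a) - v' x‖ ^ 2 := by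
  have hsh : (fun x => v (x + a)) =ᵐ[volume] fun x => v' (x + a) :=
    (measurePreserving_add_right volume a).quasiMeasurePreserving.ae_eq_comp h
  refine integral_congr_ae ?_
  filter_upwards [h, hsh] with x hx hxs
  simp only [hx, hxs]

/-- The energy `∫‖v‖²` is invariant under a.e.-modification of `v`. [folklore] -/
theorem integral_norm_sq_congr_ae {v v' : UnitAddTorus d → EuclideanSpace ℝ d} (h : v =ᵐ[volume] v') :
    ∫ x, ‖v x‖ ^ 2 = ∫ x, ‖v' x‖ ^ 2 :=
  integral_congr_ae (h.mono fun x hx => by simp only [hx])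

/-- The planar-symmetry defect functional of the lens-4 items (infimum over off-origin integer directions
`q̃ = (q₁, 0, q₂)` of `½ ∫₀¹ ∫ ‖v (x + s q̃) − v x‖²`) is invariant under a.e.-modification of `v`. [folklore] -/
theorem defect_congr_ae {v v' : UnitAddTorus (Fin 3) → EuclideanSpace ℝ (Fin 3)} (h : v =ᵐ[volume] v') :
    (⨅ q : {q : ℤ × ℤ // q ≠ 0}, (1 / 2 : ℝ) * ∫ s in (0 : ℝ)..1, ∫ x, ‖v (x + Literature.Analysis.FluidPDE.toTorus
        (fun i => s * (![((q.1.1 : ℤ) : ℝ), 0, ((q.1.2 : ℤ) : ℝ)] : Fin 3 → ℝ) i)) - v x‖ ^ 2) =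
      ⨅ q : {q : ℤ × ℤ // q ≠ 0}, (1 / 2 : ℝ) * ∫ s in (0 : ℝ)..1, ∫ x, ‖v' (x + Literature.Analysis.FluidPDE.toTorus
        (fun i => s * (![((q.1.1 : ℤ) : ℝ), 0, ((q.1.2 : ℤ) : ℝ)] : Fin 3 → ℝ) i)) - v' x‖ ^ 2 := by
  refine iInf_congr fun q => ?_
  congr 1
  refine intervalIntegral.integral_congr fun s _ => ?_
  exact integral_norm_sq_shift_sub_congr_ae h _

variable {ν ν' t₀ c₀ : ℝ} {F F' : ℝ → UnitAddTorus (Fin 3) → EuclideanSpace ℝ (Fin 3)}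
  {v₀ v₀' : UnitAddTorus (Fin 3) → EuclideanSpace ℝ (Fin 3)} {u u' : ℝ → UnitAddTorus (Fin 3) → EuclideanSpace ℝ (Fin 3)}

/-- **The ejection predicate at a positive time is pinned.**  For two global Leray–Hopf solutions (any viscosities,
forces, data) agreeing off a single time `t₀ > 0`, the defect and the energy of the slices at `t₀` coincide, so
`0 < defect (u t₀) ∧ c₀ ∫‖u t₀‖² ≤ defect (u t₀)` holds for `u` iff it holds for `u'`: the time-zero freedom of
`sliceZero_eject` decides nothing at `t > 0`. [folklore] -/
theorem sliceGlobal_eject_iff_of_eq_off (hu : IsGlobalLerayHopf ν F v₀ u) (hu' : IsGlobalLerayHopf ν' F' v₀' u')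
    (ht₀ : 0 < t₀) (h : ∀ t, t ≠ t₀ → u t = u' t) :
    (0 < (⨅ q : {q : ℤ × ℤ // q ≠ 0}, (1 / 2 : ℝ) * ∫ s in (0 : ℝ)..1, ∫ x, ‖u t₀ (x + Literature.Analysis.FluidPDE.toTorus
        (fun i => s * (![((q.1.1 : ℤ) : ℝ), 0, ((q.1.2 : ℤ) : ℝ)] : Fin 3 → ℝ) i)) - u t₀ x‖ ^ 2) ∧
      c₀ * ∫ x, ‖u t₀ x‖ ^ 2 ≤ ⨅ q : {q : ℤ × ℤ // q ≠ 0}, (1 / 2 : ℝ) * ∫ s in (0 : ℝ)..1, ∫ x,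
        ‖u t₀ (x + Literature.Analysis.FluidPDE.toTorus (fun i => s * (![((q.1.1 : ℤ) : ℝ), 0, ((q.1.2 : ℤ) : ℝ)] :
          Fin 3 → ℝ) i)) - u t₀ x‖ ^ 2) ↔
    (0 < (⨅ q : {q : ℤ × ℤ // q ≠ 0}, (1 / 2 : ℝ) * ∫ s in (0 : ℝ)..1, ∫ x, ‖u' t₀ (x + Literature.Analysis.FluidPDE.toTorus
        (fun i => s * (![((q.1.1 : ℤ) : ℝ), 0, ((q.1.2 : ℤ) : ℝ)] : Fin 3 → ℝ) i)) - u' t₀ x‖ ^ 2) ∧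
      c₀ * ∫ x, ‖u' t₀ x‖ ^ 2 ≤ ⨅ q : {q : ℤ × ℤ // q ≠ 0}, (1 / 2 : ℝ) * ∫ s in (0 : ℝ)..1, ∫ x,
        ‖u' t₀ (x + Literature.Analysis.FluidPDE.toTorus (fun i => s * (![((q.1.1 : ℤ) : ℝ), 0, ((q.1.2 : ℤ) : ℝ)] :
          Fin 3 → ℝ) i)) - u' t₀ x‖ ^ 2) := by
  have hae : u t₀ =ᵐ[volume] u' t₀ := sliceGlobal_ae_eq_of_eq_off hu hu' ht₀ h
  rw [defect_congr_ae hae, integral_norm_sq_congr_ae hae]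

end Summit.AnomalousDissipation.AnomalousDissipation.Theorems.SymmetricOrLoudPlanarStatesEject.Negative

end
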